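import Literature.Geometry.Lorentzian.SchwarzschildCylinderKIDs
import Literature.Geometry.Lorentzian.CoordAdjointCutoff
import Literature.Geometry.Lorentzian.CoordVolumeForm
import HarnessLib

/-!
# The Schwarzschild cylinder background in closed form: `♯`, traces, pairings, `√det g`, and the
# commutators `[DM*ˢ, χ]` paired against a variation, for the four tangential KIDs

Support file (all results proved; no named facts, no definitions) for the named fact
`LiMei.interiorKerrGluing` (`InteriorKerrGluing.lean`; J. Li, H. Mei, *A construction of
collapsing spacetimes in vacuum*, Comm. Math. Phys. 378 (2020) = arXiv:2005.01249, Prop. 4.1),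
step "S5" of the printed proof (pp. 23–25: the evaluation of the cokernel projections `𝓘_α`).
At the zero-spin background `G₀ = cylH M 0 r₀ τ₀ R = ḡ_M`, `K₀ = cylK M 0 _ τ₀ R = k̄_M`
(Li–Mei (4.1)) on `{1 < ‖y‖}` — with `A = 2M/r₀ − 1 > 0`, `ρ = ‖y‖`, `dt = ⟨y,·⟩/ρ` — everything
is explicit:

* `cylH_zero_spin_eq`, `cylK_zero_spin_eq` — `G₀ = A dt² + (r₀²/ρ²)(δ − dt²)`,
  `K₀ = (M√A/r₀²) dt² − (r₀√A/ρ²)(δ − dt²)`; `cylK_zero_spin_eq_smul_sub` —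
  `K₀ = (√A(3M−r₀)/r₀²) dt² − (√A/r₀) G₀`;
* `sharpAt_cylH_zero_spin` — **the inverse metric**:
  `♯θ = (θ(y)/(Aρ²)) y + (ρ²/r₀²)(θ^♯_E − (θ(y)/ρ²) y)`; in particular `♯⟨y,·⟩ = A⁻¹ y`;
* `mtrAt_cylH_zero_spin` — `tr_{G₀} T = T(y,y)/(Aρ²) + (ρ²/r₀²)(Σ_i T(e_i,e_i) − T(y,y)/ρ²)`;
* `pairAt_cylH_zero_spin_covec_smulRight`, `pairAt_cylH_cylK_zero_spin` —
  `⟨γ, ⟨y,·⟩ ⊗ ⟨y,·⟩⟩_{G₀} = γ(y,y)/A²`, `⟨γ, K₀⟩_{G₀}` in closed form;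
* `sqrtDetGram_cylH_zero_spin` — **`√det G₀ = √A r₀²/ρ²`** in the standard basis;
* `fderiv_radial_apply` — `d(χ₀ ∘ ‖·‖)_y = (χ₀'(ρ)/ρ) ⟨y, ·⟩`;
* **the paired commutators** (`CoordAdjointCutoff.lean` + the KIDs of
  `SchwarzschildCylinderKIDs.lean`), for a radial cut-off `χ = χ₀ ∘ ‖·‖` and symmetric `γ, κ`:
  `pairAt_adjMomKS_cutoff_dirVec` — `⟨κ, DM*ˢ_κ(χ ∂_t)⟩ = χ₀'(ρ)(ρ²/r₀²)(tr_E κ − κ(y,y)/ρ²)`,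
  `pairAt_adjMomGS_cutoff_dirVec` — `⟨γ, DM*ˢ_γ(χ ∂_t)⟩ = χ₀'(ρ)((M−r₀)/(2r₀²√A))(ρ²/r₀²)(tr_E γ − γ(y,y)/ρ²)`,
  `pairAt_adjMomKS_cutoff_skew` — `⟨κ, DM*ˢ_κ(χ Ω)⟩ = −(χ₀'(ρ)/(Aρ)) κ(Ωy, y)`,
  `pairAt_adjMomGS_cutoff_skew` — `⟨γ, DM*ˢ_γ(χ Ω)⟩ = −(χ₀'(ρ)/(r₀√A ρ)) γ(Ωy, y)`.

These are the integrands of the first-order obstruction map of Li–Mei (p. 25,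
`𝓘(m, a⃗) = (8π(m − m₀), −8π m₀ a⃗) + …`) in the volume form of the cokernel projections.

## References

* J. Li, H. Mei, Comm. Math. Phys. 378 (2020), arXiv:2005.01249, §4, (4.1) and pp. 23–25. [LiMei2020]
* B. O'Neill, *Semi-Riemannian geometry*, 1983, Ch. 3, pp. 60–61. [ONeill1983]
-/

noncomputable section

set_option maxSynthPendingDepth 3

open Set Filter ContinuousLinearMap Module Metric
open scoped Topology ContDiff RealInnerProductSpace

namespace Literature.Geometry.Lorentzian

namespace LiMei

open MetricCoord

section Background

variable [Kerr.Facts] {M r₀ : ℝ}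

omit [Kerr.Facts] in
/-- Inside the hole the lapse coefficient `A = 2M/r₀ − 1` of the cylinder `{r = r₀}` is positive.
[cite: LiMei2020, (4.1)] -/
theorem lapse_pos (hr₀ : 0 < r₀) (h2M : r₀ < 2 * M) : 0 < 2 * M / r₀ - 1 := by
  rw [sub_pos, lt_div_iff₀ hr₀]; linarith

omit [Kerr.Facts] in
/-- **`G₀ = A dt² + (r₀²/ρ²)(δ − dt²)`** on `{1 < ‖y‖}` (Li–Mei (4.1), `ḡ_M`). [cite: LiMei2020, (4.1)] -/
theorem cylH_zero_spin_eq (hr₀ : 0 < r₀) (τ₀ : ℝ) (R : E3 →ₗᵢ[ℝ] E3) {y : E3} (hy : 1 < ‖y‖)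
    (v w : E3) :
    cylH M 0 r₀ τ₀ R y v w = (2 * M / r₀ - 1) * (⟪y, v⟫ * ⟪y, w⟫ / ‖y‖ ^ 2) +
      r₀ ^ 2 / ‖y‖ ^ 2 * (⟪v, w⟫ - ⟪y, v⟫ * ⟪y, w⟫ / ‖y‖ ^ 2) := by
  rw [cylH_zero_spin_apply hr₀ τ₀ R hy.le, gbarRep]

/-- **`K₀ = (M√A/r₀²) dt² − (r₀√A/ρ²)(δ − dt²)`** on `{1 < ‖y‖}` (Li–Mei (4.1), `k̄_M`).
[cite: LiMei2020, (4.1)] -/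
theorem cylK_zero_spin_eq (hr₀ : 0 < r₀) (h2M : r₀ < 2 * M) (τ₀ : ℝ) (R : E3 →ₗᵢ[ℝ] E3) {y : E3}
    (hy : 1 < ‖y‖) (v w : E3) :
    cylK M 0 hr₀ τ₀ R y v w =
      M / r₀ ^ 2 * Real.sqrt (2 * M / r₀ - 1) * (⟪y, v⟫ * ⟪y, w⟫ / ‖y‖ ^ 2) -
        r₀ * Real.sqrt (2 * M / r₀ - 1) / ‖y‖ ^ 2 * (⟪v, w⟫ - ⟪y, v⟫ * ⟪y, w⟫ / ‖y‖ ^ 2) := by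
  rw [cylK_zero_spin_apply hr₀ h2M τ₀ R hy, kbarRep]

omit [Kerr.Facts] in
/-- On the radial vector: `G₀(y, w) = A ⟨y, w⟩`. [cite: LiMei2020, (4.1)] -/
theorem cylH_zero_spin_self_left (hr₀ : 0 < r₀) (τ₀ : ℝ) (R : E3 →ₗᵢ[ℝ] E3) {y : E3}
    (hy : 1 < ‖y‖) (w : E3) : cylH M 0 r₀ τ₀ R y y w = (2 * M / r₀ - 1) * ⟪y, w⟫ := by
  have hρ : ‖y‖ ≠ 0 := (zero_lt_one.trans hy).ne'
  rw [cylH_zero_spin_eq hr₀ τ₀ R hy, real_inner_self_eq_norm_sq]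
  field_simp
  ring

/-- On the radial vector: `K₀(y, w) = (M√A/r₀²) ⟨y, w⟩`. [cite: LiMei2020, (4.1)] -/
theorem cylK_zero_spin_self_left (hr₀ : 0 < r₀) (h2M : r₀ < 2 * M) (τ₀ : ℝ) (R : E3 →ₗᵢ[ℝ] E3)
    {y : E3} (hy : 1 < ‖y‖) (w : E3) :
    cylK M 0 hr₀ τ₀ R y y w = M / r₀ ^ 2 * Real.sqrt (2 * M / r₀ - 1) * ⟪y, w⟫ := by
  have hρ : ‖y‖ ≠ 0 := (zero_lt_one.trans hy).ne'
  rw [cylK_zero_spin_eq hr₀ h2M τ₀ R hy, real_inner_self_eq_norm_sq]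
  field_simp
  ring

/-- **`K₀ = (√A(3M − r₀)/r₀²) dt² − (√A/r₀) G₀`**: the second fundamental form of the cylinder is a
combination of `dt²` and the metric. [cite: LiMei2020, (4.1)] -/
theorem cylK_zero_spin_eq_smul_sub (hr₀ : 0 < r₀) (h2M : r₀ < 2 * M) (τ₀ : ℝ) (R : E3 →ₗᵢ[ℝ] E3)
    {y : E3} (hy : 1 < ‖y‖) (v w : E3) :
    cylK M 0 hr₀ τ₀ R y v w =
      Real.sqrt (2 * M / r₀ - 1) * (3 * M - r₀) / r₀ ^ 2 * (⟪y, v⟫ * ⟪y, w⟫ / ‖y‖ ^ 2) -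
        Real.sqrt (2 * M / r₀ - 1) / r₀ * cylH M 0 r₀ τ₀ R y v w := by
  have hρ : ‖y‖ ≠ 0 := (zero_lt_one.trans hy).ne'
  rw [cylK_zero_spin_eq hr₀ h2M τ₀ R hy, cylH_zero_spin_eq hr₀ τ₀ R hy]
  field_simp
  ring

/-- The same as an identity of bilinear forms: `K₀ = c • ⟨y,·⟩ ⊗ ⟨y,·⟩ − (√A/r₀) • G₀` with
`c = √A(3M − r₀)/(r₀² ρ²)`. [cite: LiMei2020, (4.1)] -/
theorem cylK_zero_spin_eq_smul_sub' (hr₀ : 0 < r₀) (h2M : r₀ < 2 * M) (τ₀ : ℝ) (R : E3 →ₗᵢ[ℝ] E3)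
    {y : E3} (hy : 1 < ‖y‖) :
    cylK M 0 hr₀ τ₀ R y =
      (Real.sqrt (2 * M / r₀ - 1) * (3 * M - r₀) / (r₀ ^ 2 * ‖y‖ ^ 2)) •
          (E3.covec y).smulRight (E3.covec y) -
        (Real.sqrt (2 * M / r₀ - 1) / r₀) • cylH M 0 r₀ τ₀ R y := by
  ext v w
  rw [cylK_zero_spin_eq_smul_sub hr₀ h2M τ₀ R hy]
  simp only [_root_.sub_apply, _root_.smul_apply, ContinuousLinearMap.smulRight_apply,
    E3.covec_apply, smul_eq_mul]
  ring

omit [Kerr.Facts] in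
/-- **The inverse metric of the cylinder background**: for every covector `θ`,
`♯_{G₀}θ = (θ(y)/(Aρ²)) y + (ρ²/r₀²)(θ^♯_E − (θ(y)/ρ²) y)` (radial eigenvalue `A`, tangential
eigenvalue `r₀²/ρ²`; `θ^♯_E` the Euclidean sharp). [cite: ONeill1983, Ch. 3, pp. 60–61] -/
theorem sharpAt_cylH_zero_spin (hr₀ : 0 < r₀) (h2M : r₀ < 2 * M) (τ₀ : ℝ) (R : E3 →ₗᵢ[ℝ] E3)
    {y : E3} (hy : 1 < ‖y‖) (hi : (cylH M 0 r₀ τ₀ R y).IsInvertible) (θ : E3 →L[ℝ] ℝ) :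
    sharpAt (cylH M 0 r₀ τ₀ R) y θ =
      ((2 * M / r₀ - 1)⁻¹ * θ y / ‖y‖ ^ 2) • y +
        (‖y‖ ^ 2 / r₀ ^ 2) • ((InnerProductSpace.toDual ℝ E3).symm θ - (θ y / ‖y‖ ^ 2) • y) := by
  have hρ : ‖y‖ ≠ 0 := (zero_lt_one.trans hy).ne'
  have hA : 2 * M / r₀ - 1 ≠ 0 := (lapse_pos hr₀ h2M).ne'
  have hr : r₀ ≠ 0 := hr₀.ne'
  set v : E3 := ((2 * M / r₀ - 1)⁻¹ * θ y / ‖y‖ ^ 2) • y +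
    (‖y‖ ^ 2 / r₀ ^ 2) • ((InnerProductSpace.toDual ℝ E3).symm θ - (θ y / ‖y‖ ^ 2) • y) with hv
  have hGv : cylH M 0 r₀ τ₀ R y v = θ := by
    ext w
    have hyv : ⟪y, v⟫ = (2 * M / r₀ - 1)⁻¹ * θ y := by
      rw [hv, inner_add_right, inner_smul_right, inner_smul_right, inner_sub_right, inner_smul_right,
        real_inner_self_eq_norm_sq, real_inner_comm, InnerProductSpace.toDual_symm_apply]
      field_simp
      ring
    have hvw : ⟪v, w⟫ = (2 * M / r₀ - 1)⁻¹ * θ y / ‖y‖ ^ 2 * ⟪y, w⟫ +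
        ‖y‖ ^ 2 / r₀ ^ 2 * (θ w - θ y / ‖y‖ ^ 2 * ⟪y, w⟫) := by
      rw [hv, inner_add_left, inner_smul_left, inner_smul_left, inner_sub_left, inner_smul_left,
        InnerProductSpace.toDual_symm_apply]
      simp only [conj_trivial]
    rw [cylH_zero_spin_eq hr₀ τ₀ R hy, hyv, hvw]
    set A := 2 * M / r₀ - 1 with hAdef
    field_simp
    ring
  rw [← hGv, sharpAt_apply hi]

omit [Kerr.Facts] in
/-- **`♯⟨y, ·⟩ = A⁻¹ y`** at the cylinder background. [cite: ONeill1983, Ch. 3, pp. 60–61] -/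
theorem sharpAt_cylH_zero_spin_covec (hr₀ : 0 < r₀) (h2M : r₀ < 2 * M) (τ₀ : ℝ)
    (R : E3 →ₗᵢ[ℝ] E3) {y : E3} (hy : 1 < ‖y‖) (hi : (cylH M 0 r₀ τ₀ R y).IsInvertible) :
    sharpAt (cylH M 0 r₀ τ₀ R) y (E3.covec y) = (2 * M / r₀ - 1)⁻¹ • y := by
  have hρ : ‖y‖ ≠ 0 := (zero_lt_one.trans hy).ne'
  have hsymm : (InnerProductSpace.toDual ℝ E3).symm (E3.covec y) = y := by
    apply (InnerProductSpace.toDual ℝ E3).injective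
    rw [LinearIsometryEquiv.apply_symm_apply]
    ext w
    rw [InnerProductSpace.toDual_apply_apply, E3.covec_apply]
  rw [sharpAt_cylH_zero_spin hr₀ h2M τ₀ R hy hi, hsymm, E3.covec_apply, real_inner_self_eq_norm_sq]
  have h1 : (‖y‖ ^ 2 / ‖y‖ ^ 2 : ℝ) = 1 := div_self (pow_ne_zero 2 hρ)
  rw [h1, one_smul, sub_self, smul_zero, add_zero]
  congr 1
  field_simp

omit [Kerr.Facts] in
/-- `♯(G₀(v, ·)) = v`. [folklore] -/
theorem sharpAt_cylH_zero_spin_apply (τ₀ : ℝ) (R : E3 →ₗᵢ[ℝ] E3) {y : E3}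
    (hi : (cylH M 0 r₀ τ₀ R y).IsInvertible) (v : E3) :
    sharpAt (cylH M 0 r₀ τ₀ R) y (cylH M 0 r₀ τ₀ R y v) = v :=
  sharpAt_apply hi v

omit [Kerr.Facts] in
/-- The coordinates of the Euclidean sharp: `(θ^♯_E)_i = θ(e_i)`. [folklore] -/
theorem toDual_symm_apply_coord (θ : E3 →L[ℝ] ℝ) (i : Fin 3) :
    ((InnerProductSpace.toDual ℝ E3).symm θ) i = θ (EuclideanSpace.single i 1) := by
  have h := EuclideanSpace.inner_single_left (𝕜 := ℝ) i (1 : ℝ)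
    ((InnerProductSpace.toDual ℝ E3).symm θ)
  rw [map_one, one_mul] at h
  rw [← h, real_inner_comm, InnerProductSpace.toDual_symm_apply]

omit [Kerr.Facts] in
/-- `T(y, y) = Σ_i y_i T(e_i, y)` (expansion of the first slot in the standard basis). [folklore] -/
theorem apply_self_eq_sum_coord (T : E3 →L[ℝ] E3 →L[ℝ] ℝ) (y : E3) :
    T y y = ∑ i, y i * T (EuclideanSpace.single i 1) y := by
  have hrep : ∑ i, y i • EuclideanSpace.single i (1 : ℝ) = y := by
    have h := (EuclideanSpace.basisFun (Fin 3) ℝ).sum_repr y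
    simp only [EuclideanSpace.basisFun_repr, EuclideanSpace.basisFun_apply] at h
    exact h
  have h := congrArg (fun v ↦ T v y) hrep.symm
  simp only at h
  rw [h, map_sum, FunLike.coe_sum, Finset.sum_apply]
  refine Finset.sum_congr rfl fun i _ ↦ ?_
  rw [map_smul, _root_.smul_apply, smul_eq_mul]

omit [Kerr.Facts] in
/-- **The metric trace at the cylinder background**:
`tr_{G₀} T = T(y,y)/(Aρ²) + (ρ²/r₀²)(Σ_i T(e_i,e_i) − T(y,y)/ρ²)`. [cite: ONeill1983, Ch. 3, pp. 60–61] -/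
theorem mtrAt_cylH_zero_spin (hr₀ : 0 < r₀) (h2M : r₀ < 2 * M) (τ₀ : ℝ) (R : E3 →ₗᵢ[ℝ] E3)
    {y : E3} (hy : 1 < ‖y‖) (hi : (cylH M 0 r₀ τ₀ R y).IsInvertible) (T : E3 →L[ℝ] E3 →L[ℝ] ℝ) :
    mtrAt (cylH M 0 r₀ τ₀ R) y T =
      (2 * M / r₀ - 1)⁻¹ * T y y / ‖y‖ ^ 2 +
        ‖y‖ ^ 2 / r₀ ^ 2 * (∑ i, T (EuclideanSpace.single i 1) (EuclideanSpace.single i 1) -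
          T y y / ‖y‖ ^ 2) := by
  set b := (EuclideanSpace.basisFun (Fin 3) ℝ).toBasis with hb
  have hcoord : ∀ (i : Fin 3) (v : E3), b.coord i v = v i := fun i v ↦ by
    rw [hb, Basis.coord_apply, OrthonormalBasis.coe_toBasis_repr_apply, EuclideanSpace.basisFun_repr]
  have hbi : ∀ i : Fin 3, b i = EuclideanSpace.single i 1 := fun i ↦ by
    rw [hb, OrthonormalBasis.coe_toBasis, EuclideanSpace.basisFun_apply]
  rw [mtrAt, trace_eq_sum_coord b]
  simp only [ContinuousLinearMap.coe_coe, ContinuousLinearMap.comp_apply, hcoord, hbi,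
    sharpAt_cylH_zero_spin hr₀ h2M τ₀ R hy hi, PiLp.add_apply, PiLp.smul_apply, PiLp.sub_apply,
    smul_eq_mul, toDual_symm_apply_coord]
  -- `Σ_i y_i T(e_i, y) = T(y, y)` (symmetry is not needed: the first slot is expanded)
  have hflip : ∀ i : Fin 3, T (EuclideanSpace.single i 1) y =
      (T.flip y) (EuclideanSpace.single i 1) := fun i ↦ by rw [ContinuousLinearMap.flip_apply]
  have hsum : ∑ i, y i * T (EuclideanSpace.single i 1) y = T y y := (apply_self_eq_sum_coord T y).symm
  have hsum' : ∑ i : Fin 3, T (EuclideanSpace.single i 1) y * y i = T y y := by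
    rw [← hsum]; exact Finset.sum_congr rfl fun i _ ↦ mul_comm _ _
  have h1 : ∑ i : Fin 3, (2 * M / r₀ - 1)⁻¹ * T (EuclideanSpace.single i 1) y / ‖y‖ ^ 2 * y i =
      (2 * M / r₀ - 1)⁻¹ * T y y / ‖y‖ ^ 2 := by
    rw [← hsum', Finset.mul_sum, Finset.sum_div]
    exact Finset.sum_congr rfl fun i _ ↦ by ring
  have h2 : ∑ i : Fin 3, T (EuclideanSpace.single i 1) y / ‖y‖ ^ 2 * y i = T y y / ‖y‖ ^ 2 := by
    rw [← hsum', Finset.sum_div]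
    exact Finset.sum_congr rfl fun i _ ↦ by ring
  rw [Finset.sum_add_distrib, h1, ← Finset.mul_sum, Finset.sum_sub_distrib, h2]

/-! ### Pairings with `dt²` and with `K₀` -/

/-- **`⟨α, ⟨y,·⟩ ⊗ ⟨y,·⟩⟩_{G₀} = α(y, y)/A²`.** [cite: ONeill1983, Ch. 3, pp. 60–61] -/
theorem pairAt_cylH_zero_spin_covec_smulRight (hr₀ : 0 < r₀) (h2M : r₀ < 2 * M) (τ₀ : ℝ)
    (R : E3 →ₗᵢ[ℝ] E3) {y : E3} (hy : 1 < ‖y‖) (α : E3 →L[ℝ] E3 →L[ℝ] ℝ) :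
    pairAt (cylH M 0 r₀ τ₀ R) y α ((E3.covec y).smulRight (E3.covec y)) =
      (2 * M / r₀ - 1)⁻¹ ^ 2 * α y y := by
  have hG := isMetricOn_cylH_zero_spin hr₀ h2M τ₀ R
  have hi := hG.isInvertible y hy
  rw [pairAt_smulRight_right hi (hG.symm y hy), sharpAt_cylH_zero_spin_covec hr₀ h2M τ₀ R hy hi]
  simp only [map_smul, _root_.smul_apply, smul_eq_mul]
  ring

/-- **`⟨γ, K₀⟩_{G₀} = (√A(3M − r₀)/(r₀²ρ²A²)) γ(y,y) − (√A/r₀) tr_{G₀} γ`.** [cite: LiMei2020, (4.1)] -/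
theorem pairAt_cylH_cylK_zero_spin (hr₀ : 0 < r₀) (h2M : r₀ < 2 * M) (τ₀ : ℝ) (R : E3 →ₗᵢ[ℝ] E3)
    {y : E3} (hy : 1 < ‖y‖) (γx : E3 →L[ℝ] E3 →L[ℝ] ℝ) :
    pairAt (cylH M 0 r₀ τ₀ R) y γx (cylK M 0 hr₀ τ₀ R y) =
      Real.sqrt (2 * M / r₀ - 1) * (3 * M - r₀) / (r₀ ^ 2 * ‖y‖ ^ 2) * (2 * M / r₀ - 1)⁻¹ ^ 2 *
          γx y y -
        Real.sqrt (2 * M / r₀ - 1) / r₀ * mtrAt (cylH M 0 r₀ τ₀ R) y γx := by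
  have hG := isMetricOn_cylH_zero_spin hr₀ h2M τ₀ R
  have hi := hG.isInvertible y hy
  rw [cylK_zero_spin_eq_smul_sub' hr₀ h2M τ₀ R hy, pairAt_sub_right, pairAt_smul_right,
    pairAt_smul_right, pairAt_cylH_zero_spin_covec_smulRight hr₀ h2M τ₀ R hy,
    pairAt_metric_right hi]
  ring

/-! ### Radial cut-offs -/

omit [Kerr.Facts] in
/-- **The differential of a radial function**: `d(χ₀ ∘ ‖·‖)_y = (χ₀'(‖y‖)/‖y‖) ⟨y, ·⟩` off the
origin. [folklore] -/
theorem fderiv_radial {χ₀ : ℝ → ℝ} {y : E3} (hχ : DifferentiableAt ℝ χ₀ ‖y‖) (hy : y ≠ 0) :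
    fderiv ℝ (fun z : E3 ↦ χ₀ ‖z‖) y = (deriv χ₀ ‖y‖ * ‖y‖⁻¹) • E3.covec y := by
  have h := hχ.hasDerivAt.comp_hasFDerivAt y (Kerr.hasFDerivAt_norm_E3 hy)
  rw [show (fun z : E3 ↦ χ₀ ‖z‖) = χ₀ ∘ norm from rfl, h.fderiv, smul_smul]

omit [Kerr.Facts] in
/-- `d(χ₀ ∘ ‖·‖)_y(v) = (χ₀'(‖y‖)/‖y‖) ⟨y, v⟩`. [folklore] -/
theorem fderiv_radial_apply {χ₀ : ℝ → ℝ} {y : E3} (hχ : DifferentiableAt ℝ χ₀ ‖y‖) (hy : y ≠ 0)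
    (v : E3) : fderiv ℝ (fun z : E3 ↦ χ₀ ‖z‖) y v = deriv χ₀ ‖y‖ * ‖y‖⁻¹ * ⟪y, v⟫ := by
  rw [fderiv_radial hχ hy, _root_.smul_apply, E3.covec_apply, smul_eq_mul]

omit [Kerr.Facts] in
/-- A radial function with differentiable profile is differentiable off the origin. [folklore] -/
theorem differentiableAt_radial {χ₀ : ℝ → ℝ} {y : E3} (hχ : DifferentiableAt ℝ χ₀ ‖y‖)
    (hy : y ≠ 0) : DifferentiableAt ℝ (fun z : E3 ↦ χ₀ ‖z‖) y :=
  (hχ.hasDerivAt.comp_hasFDerivAt y (Kerr.hasFDerivAt_norm_E3 hy)).differentiableAt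

omit [Kerr.Facts] in
/-- **`♯dχ = (χ₀'(ρ)/(ρA)) y`** at the cylinder background. [cite: LiMei2020, proof of Prop. 4.1, p. 23] -/
theorem sharpAt_fderiv_radial (hr₀ : 0 < r₀) (h2M : r₀ < 2 * M) (τ₀ : ℝ) (R : E3 →ₗᵢ[ℝ] E3)
    {y : E3} (hy : 1 < ‖y‖) (hi : (cylH M 0 r₀ τ₀ R y).IsInvertible) {χ₀ : ℝ → ℝ}
    (hχ : DifferentiableAt ℝ χ₀ ‖y‖) :
    sharpAt (cylH M 0 r₀ τ₀ R) y (fderiv ℝ (fun z : E3 ↦ χ₀ ‖z‖) y) =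
      (deriv χ₀ ‖y‖ * ‖y‖⁻¹ * (2 * M / r₀ - 1)⁻¹) • y := by
  rw [fderiv_radial hχ (ne_zero_of_one_lt_norm hy), map_smul,
    sharpAt_cylH_zero_spin_covec hr₀ h2M τ₀ R hy hi, smul_smul]

/-! ### The paired commutators for `∂_t = y/‖y‖` -/

/-- **`⟨κ, DM*ˢ_κ(χ ∂_t)⟩_{G₀} = χ₀'(ρ) (ρ²/r₀²) (tr_E κ − κ(y,y)/ρ²)`** at the Schwarzschild cylinder
background, for a radial cut-off `χ = χ₀ ∘ ‖·‖` and symmetric `κ` (the `κ`-integrand of the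
projection onto the KID `(0, ∂_t)`). [cite: LiMei2020, proof of Prop. 4.1, pp. 23–24] -/
theorem pairAt_adjMomKS_cutoff_dirVec (hr₀ : 0 < r₀) (h2M : r₀ < 2 * M) (τ₀ : ℝ)
    (R : E3 →ₗᵢ[ℝ] E3) {y : E3} (hy : 1 < ‖y‖) {χ₀ : ℝ → ℝ} (hχ : DifferentiableAt ℝ χ₀ ‖y‖)
    {κx : E3 →L[ℝ] E3 →L[ℝ] ℝ} (hκs : ∀ v w, κx v w = κx w v) :
    pairAt (cylH M 0 r₀ τ₀ R) y κx
        (adjMomKS (cylH M 0 r₀ τ₀ R) (fun z ↦ χ₀ ‖z‖ • dirVec z) y) =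
      deriv χ₀ ‖y‖ * (‖y‖ ^ 2 / r₀ ^ 2) *
        (∑ i, κx (EuclideanSpace.single i 1) (EuclideanSpace.single i 1) - κx y y / ‖y‖ ^ 2) := by
  have hy0 := ne_zero_of_one_lt_norm hy
  have hρ : ‖y‖ ≠ 0 := norm_ne_zero_iff.2 hy0
  have hA : 2 * M / r₀ - 1 ≠ 0 := (lapse_pos hr₀ h2M).ne'
  have hG := isMetricOn_cylH_zero_spin hr₀ h2M τ₀ R
  have hi := hG.isInvertible y hy
  rw [hG.pairAt_adjMomKS_smul_of_kid (ψ := fun z ↦ χ₀ ‖z‖) (X := dirVec) hy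
      (differentiableAt_radial hχ hy0) (hasFDerivAt_dirVec hy0).differentiableAt
      (adjMomS_cylinder_dirVec_eq_zero hr₀ h2M τ₀ R hy).2 hκs,
    sharpAt_fderiv_radial hr₀ h2M τ₀ R hy hi hχ, fderiv_radial_apply hχ hy0,
    mtrAt_cylH_zero_spin hr₀ h2M τ₀ R hy hi]
  simp only [dirVec, map_smul, _root_.smul_apply, smul_eq_mul, inner_smul_right,
    real_inner_self_eq_norm_sq]
  set A := 2 * M / r₀ - 1 with hAdef
  field_simp
  ring

/-- `K₀(y, ·) = (M√A/r₀²) ⟨y, ·⟩` as covectors. [cite: LiMei2020, (4.1)] -/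
theorem cylK_zero_spin_self (hr₀ : 0 < r₀) (h2M : r₀ < 2 * M) (τ₀ : ℝ) (R : E3 →ₗᵢ[ℝ] E3)
    {y : E3} (hy : 1 < ‖y‖) :
    cylK M 0 hr₀ τ₀ R y y = (M / r₀ ^ 2 * Real.sqrt (2 * M / r₀ - 1)) • E3.covec y := by
  ext w
  rw [cylK_zero_spin_self_left hr₀ h2M τ₀ R hy, _root_.smul_apply, E3.covec_apply, smul_eq_mul]

/-- **`⟨γ, DM*ˢ_γ(χ ∂_t)⟩_{G₀} = χ₀'(ρ) ((M − r₀)/(2r₀²√A)) (ρ²/r₀²) (tr_E γ − γ(y,y)/ρ²)`** at the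
Schwarzschild cylinder background, for a radial cut-off and symmetric `γ` (the `γ`-integrand of the
projection onto `(0, ∂_t)`; the `γ(y,y)` coefficient cancels). [cite: LiMei2020, proof of Prop. 4.1, pp. 23–24] -/
theorem pairAt_adjMomGS_cutoff_dirVec (hr₀ : 0 < r₀) (h2M : r₀ < 2 * M) (τ₀ : ℝ)
    (R : E3 →ₗᵢ[ℝ] E3) {y : E3} (hy : 1 < ‖y‖) {χ₀ : ℝ → ℝ} (hχ : DifferentiableAt ℝ χ₀ ‖y‖)
    {γx : E3 →L[ℝ] E3 →L[ℝ] ℝ} (hγs : ∀ v w, γx v w = γx w v) :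
    pairAt (cylH M 0 r₀ τ₀ R) y γx
        (adjMomGS (cylH M 0 r₀ τ₀ R) (cylK M 0 hr₀ τ₀ R) (fun z ↦ χ₀ ‖z‖ • dirVec z) y) =
      deriv χ₀ ‖y‖ * ((M - r₀) / (2 * r₀ ^ 2 * Real.sqrt (2 * M / r₀ - 1))) * (‖y‖ ^ 2 / r₀ ^ 2) *
        (∑ i, γx (EuclideanSpace.single i 1) (EuclideanSpace.single i 1) - γx y y / ‖y‖ ^ 2) := by
  have hy0 := ne_zero_of_one_lt_norm hy
  have hρ : ‖y‖ ≠ 0 := norm_ne_zero_iff.2 hy0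
  have hApos := lapse_pos hr₀ h2M
  have hA : 2 * M / r₀ - 1 ≠ 0 := hApos.ne'
  have hr : r₀ ≠ 0 := hr₀.ne'
  have hG := isMetricOn_cylH_zero_spin hr₀ h2M τ₀ R
  have hi := hG.isInvertible y hy
  have hKX : DifferentiableAt ℝ
      (fun z ↦ sharpAt (cylH M 0 r₀ τ₀ R) z (cylK M 0 hr₀ τ₀ R z (dirVec z))) y :=
    (((hG.contDiffOn_sharpAt.clm_apply
      ((contDiff_cylK_zero_spin hr₀ h2M τ₀ R).contDiffOn.clm_apply contDiffOn_dirVec)) y hy).contDiffAt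
        (hG.mem_nhds hy)).differentiableAt (by simp)
  -- `♯K₀(∂_t, ·) = (M√A/(r₀² ρ A)) y`
  have hKsharp : sharpAt (cylH M 0 r₀ τ₀ R) y (cylK M 0 hr₀ τ₀ R y (dirVec y)) =
      (‖y‖⁻¹ * (M / r₀ ^ 2 * Real.sqrt (2 * M / r₀ - 1)) * (2 * M / r₀ - 1)⁻¹) • y := by
    rw [dirVec, map_smul, cylK_zero_spin_self hr₀ h2M τ₀ R hy, map_smul, map_smul,
      sharpAt_cylH_zero_spin_covec hr₀ h2M τ₀ R hy hi, smul_smul, smul_smul]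
  rw [hG.pairAt_adjMomGS_smul_of_kid (ψ := fun z ↦ χ₀ ‖z‖) (X := dirVec) hy
      (differentiableAt_radial hχ hy0) (hasFDerivAt_dirVec hy0).differentiableAt hKX
      (adjMomS_cylinder_dirVec_eq_zero hr₀ h2M τ₀ R hy).1 hγs,
    hKsharp, sharpAt_fderiv_radial hr₀ h2M τ₀ R hy hi hχ, fderiv_radial_apply hχ hy0,
    fderiv_radial_apply hχ hy0, mtrAt_cylH_zero_spin hr₀ h2M τ₀ R hy hi,
    pairAt_cylH_cylK_zero_spin hr₀ h2M τ₀ R hy, mtrAt_cylH_zero_spin hr₀ h2M τ₀ R hy hi]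
  simp only [dirVec, map_smul, _root_.smul_apply, smul_eq_mul, inner_smul_right,
    real_inner_self_eq_norm_sq]
  set s := Real.sqrt (2 * M / r₀ - 1) with hsdef
  have hs0 : s ≠ 0 := (Real.sqrt_pos.2 hApos).ne'
  have hs2 : 2 * M / r₀ - 1 = s ^ 2 := (Real.sq_sqrt hApos.le).symm
  have hM : M = r₀ * (s ^ 2 + 1) / 2 := by
    field_simp at hs2 ⊢
    linarith
  rw [hs2]
  rw [hM]
  field_simp
  ring

/-! ### The paired commutators for the rotations `Ω` -/

omit [Kerr.Facts] in
/-- A skew map is orthogonal to the position: `⟨y, Ω y⟩ = 0`. [folklore] -/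
theorem inner_skew_self (Ω : E3 →L[ℝ] E3) (hΩ : ∀ u u' : E3, ⟪Ω u, u'⟫ = -⟪u, Ω u'⟫) (y : E3) :
    ⟪y, Ω y⟫ = 0 := by
  have h := hΩ y y
  rw [real_inner_comm] at h
  linarith

/-- **`⟨κ, DM*ˢ_κ(χ Ω)⟩_{G₀} = −(χ₀'(ρ)/(ρA)) κ(Ωy, y)`** at the Schwarzschild cylinder background,
for a radial cut-off, a skew `Ω` and symmetric `κ` (the `κ`-integrand of the projection onto the
rotational KID `(0, Ω)`). [cite: LiMei2020, proof of Prop. 4.1, pp. 23–25] -/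
theorem pairAt_adjMomKS_cutoff_skew (hr₀ : 0 < r₀) (h2M : r₀ < 2 * M) (τ₀ : ℝ)
    (R : E3 →ₗᵢ[ℝ] E3) (Ω : E3 →L[ℝ] E3) (hΩ : ∀ u u' : E3, ⟪Ω u, u'⟫ = -⟪u, Ω u'⟫) {y : E3}
    (hy : 1 < ‖y‖) {χ₀ : ℝ → ℝ} (hχ : DifferentiableAt ℝ χ₀ ‖y‖)
    {κx : E3 →L[ℝ] E3 →L[ℝ] ℝ} (hκs : ∀ v w, κx v w = κx w v) :
    pairAt (cylH M 0 r₀ τ₀ R) y κx (adjMomKS (cylH M 0 r₀ τ₀ R) (fun z ↦ χ₀ ‖z‖ • Ω z) y) =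
      -(deriv χ₀ ‖y‖ / (‖y‖ * (2 * M / r₀ - 1))) * κx (Ω y) y := by
  have hy0 := ne_zero_of_one_lt_norm hy
  have hρ : ‖y‖ ≠ 0 := norm_ne_zero_iff.2 hy0
  have hA : 2 * M / r₀ - 1 ≠ 0 := (lapse_pos hr₀ h2M).ne'
  have hG := isMetricOn_cylH_zero_spin hr₀ h2M τ₀ R
  have hi := hG.isInvertible y hy
  rw [hG.pairAt_adjMomKS_smul_of_kid (ψ := fun z ↦ χ₀ ‖z‖) (X := fun z ↦ Ω z) hy
      (differentiableAt_radial hχ hy0) (Ω.differentiableAt)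
      (adjMomS_cylinder_skew_eq_zero hr₀ h2M τ₀ R Ω hΩ hy).2 hκs,
    sharpAt_fderiv_radial hr₀ h2M τ₀ R hy hi hχ, fderiv_radial_apply hχ hy0, inner_skew_self Ω hΩ]
  simp only [map_smul, smul_eq_mul]
  set A := 2 * M / r₀ - 1 with hAdef
  field_simp
  ring

/-- `K₀(Ωy, ·) = −(√A/r₀) G₀(Ωy, ·)` for a skew `Ω` (`Ωy` is tangential). [cite: LiMei2020, (4.1)] -/
theorem cylK_zero_spin_skew (hr₀ : 0 < r₀) (h2M : r₀ < 2 * M) (τ₀ : ℝ) (R : E3 →ₗᵢ[ℝ] E3)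
    (Ω : E3 →L[ℝ] E3) (hΩ : ∀ u u' : E3, ⟪Ω u, u'⟫ = -⟪u, Ω u'⟫) {y : E3} (hy : 1 < ‖y‖) :
    cylK M 0 hr₀ τ₀ R y (Ω y) = -(Real.sqrt (2 * M / r₀ - 1) / r₀) • cylH M 0 r₀ τ₀ R y (Ω y) := by
  ext w
  rw [cylK_zero_spin_eq_smul_sub hr₀ h2M τ₀ R hy, inner_skew_self Ω hΩ, _root_.smul_apply,
    smul_eq_mul]
  ring

/-- **`⟨γ, DM*ˢ_γ(χ Ω)⟩_{G₀} = −(χ₀'(ρ)/(r₀ √A ρ)) γ(Ωy, y)`** at the Schwarzschild cylinder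
background, for a radial cut-off, a skew `Ω` and symmetric `γ` (the `γ`-integrand of the projection
onto `(0, Ω)`). [cite: LiMei2020, proof of Prop. 4.1, pp. 23–25] -/
theorem pairAt_adjMomGS_cutoff_skew (hr₀ : 0 < r₀) (h2M : r₀ < 2 * M) (τ₀ : ℝ)
    (R : E3 →ₗᵢ[ℝ] E3) (Ω : E3 →L[ℝ] E3) (hΩ : ∀ u u' : E3, ⟪Ω u, u'⟫ = -⟪u, Ω u'⟫) {y : E3}
    (hy : 1 < ‖y‖) {χ₀ : ℝ → ℝ} (hχ : DifferentiableAt ℝ χ₀ ‖y‖)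
    {γx : E3 →L[ℝ] E3 →L[ℝ] ℝ} (hγs : ∀ v w, γx v w = γx w v) :
    pairAt (cylH M 0 r₀ τ₀ R) y γx
        (adjMomGS (cylH M 0 r₀ τ₀ R) (cylK M 0 hr₀ τ₀ R) (fun z ↦ χ₀ ‖z‖ • Ω z) y) =
      -(deriv χ₀ ‖y‖ / (r₀ * Real.sqrt (2 * M / r₀ - 1) * ‖y‖)) * γx (Ω y) y := by
  have hy0 := ne_zero_of_one_lt_norm hy
  have hρ : ‖y‖ ≠ 0 := norm_ne_zero_iff.2 hy0
  have hApos := lapse_pos hr₀ h2M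
  have hA : 2 * M / r₀ - 1 ≠ 0 := hApos.ne'
  have hr : r₀ ≠ 0 := hr₀.ne'
  have hG := isMetricOn_cylH_zero_spin hr₀ h2M τ₀ R
  have hi := hG.isInvertible y hy
  have hKX : DifferentiableAt ℝ
      (fun z ↦ sharpAt (cylH M 0 r₀ τ₀ R) z (cylK M 0 hr₀ τ₀ R z (Ω z))) y :=
    (((hG.contDiffOn_sharpAt.clm_apply
      ((contDiff_cylK_zero_spin hr₀ h2M τ₀ R).contDiffOn.clm_apply Ω.contDiff.contDiffOn)) y hy).contDiffAt
        (hG.mem_nhds hy)).differentiableAt (by simp)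
  have hKsharp : sharpAt (cylH M 0 r₀ τ₀ R) y (cylK M 0 hr₀ τ₀ R y (Ω y)) =
      -(Real.sqrt (2 * M / r₀ - 1) / r₀) • Ω y := by
    rw [cylK_zero_spin_skew hr₀ h2M τ₀ R Ω hΩ hy, map_smul, sharpAt_apply hi]
  rw [hG.pairAt_adjMomGS_smul_of_kid (ψ := fun z ↦ χ₀ ‖z‖) (X := fun z ↦ Ω z) hy
      (differentiableAt_radial hχ hy0) Ω.differentiableAt hKX
      (adjMomS_cylinder_skew_eq_zero hr₀ h2M τ₀ R Ω hΩ hy).1 hγs,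
    hKsharp, sharpAt_fderiv_radial hr₀ h2M τ₀ R hy hi hχ, fderiv_radial_apply hχ hy0,
    fderiv_radial_apply hχ hy0, inner_smul_right, inner_skew_self Ω hΩ]
  simp only [map_smul, _root_.smul_apply, smul_eq_mul, mul_zero, zero_mul, sub_zero]
  set s := Real.sqrt (2 * M / r₀ - 1) with hsdef
  have hs0 : s ≠ 0 := (Real.sqrt_pos.2 hApos).ne'
  have hs2 : 2 * M / r₀ - 1 = s ^ 2 := (Real.sq_sqrt hApos.le).symm
  rw [hs2]
  field_simp

/-! ### The volume density -/

omit [Kerr.Facts] in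
/-- **`√det G₀ = √A r₀²/ρ²`** in the standard basis of `E3` (radial eigenvalue `A`, double
tangential eigenvalue `r₀²/ρ²`). [cite: LiMei2020, (4.1)] -/
theorem sqrtDetGram_cylH_zero_spin (hr₀ : 0 < r₀) (h2M : r₀ < 2 * M) (τ₀ : ℝ) (R : E3 →ₗᵢ[ℝ] E3)
    {y : E3} (hy : 1 < ‖y‖) :
    sqrtDetGram (cylH M 0 r₀ τ₀ R) (EuclideanSpace.basisFun (Fin 3) ℝ).toBasis y =
      Real.sqrt (2 * M / r₀ - 1) * r₀ ^ 2 / ‖y‖ ^ 2 := by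
  classical
  have hy0 := ne_zero_of_one_lt_norm hy
  have hρ : ‖y‖ ≠ 0 := norm_ne_zero_iff.2 hy0
  have hApos := lapse_pos hr₀ h2M
  have hn : ‖y‖ ^ 2 = y 0 ^ 2 + y 1 ^ 2 + y 2 ^ 2 := by
    rw [EuclideanSpace.real_norm_sq_eq, Fin.sum_univ_three]
  have hent : ∀ i k : Fin 3, cylH M 0 r₀ τ₀ R y (EuclideanSpace.single i 1) (EuclideanSpace.single k 1) =
      (2 * M / r₀ - 1) * (y i * y k / ‖y‖ ^ 2) +
        r₀ ^ 2 / ‖y‖ ^ 2 * ((if i = k then 1 else 0) - y i * y k / ‖y‖ ^ 2) := by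
    intro i k
    rw [cylH_zero_spin_eq hr₀ τ₀ R hy, EuclideanSpace.inner_single_right, EuclideanSpace.inner_single_right,
      EuclideanSpace.inner_single_left, PiLp.single_apply]
    simp only [map_one, one_mul, conj_trivial]
  have hdet : (gramMatrix (cylH M 0 r₀ τ₀ R) (EuclideanSpace.basisFun (Fin 3) ℝ).toBasis y).det =
      (Real.sqrt (2 * M / r₀ - 1) * r₀ ^ 2 / ‖y‖ ^ 2) ^ 2 := by
    rw [div_pow, mul_pow, Real.sq_sqrt hApos.le, Matrix.det_fin_three]
    simp only [gramMatrix, Matrix.of_apply, OrthonormalBasis.coe_toBasis, EuclideanSpace.basisFun_apply,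
      hent]
    simp only [Fin.isValue, ↓reduceIte, Fin.reduceEq]
    field_simp
    simp only [show ‖y‖ ^ 8 = (‖y‖ ^ 2) ^ 4 by ring, hn]
    ring
  rw [sqrtDetGram, hdet, Real.sqrt_sq (by positivity)]

end Background

end LiMei

end Literature.Geometry.Lorentzian

end
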